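import Literature.MathematicalPhysics.QuantumLattice.HeisenbergCouplingReflection
import Literature.MathematicalPhysics.QuantumLattice.PeierlsInstabilityRing
import HarnessLib

/-!
# Dimerization for the spin-Peierls ring (Lieb–Nachtergaele 1995, Theorem 4, `d = 1`)

E. H. Lieb, B. Nachtergaele, *Stability of the Peierls instability for ring-shaped molecules*,
Phys. Rev. B **51** (1995) 4777 (= cond-mat/9410100), §1 "The spin-Peierls problem" and Theorem 4
(`spinpeierls`), proof in §3.

**The spin-Peierls problem** (eq. (1.9), `heisham`): minimise the smallest eigenvalue of
`H_Λ = Σ_{⟨i,j⟩} J_{ij} 𝐒_i·𝐒_j + Σ_{⟨i,j⟩} f(J_{ij})` over the configurations of antiferromagnetic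
couplings `J_{ij} ≥ 0` on the nearest-neighbour bonds of a box with periodic boundary conditions,
`f` an arbitrary elastic energy. **Theorem 4**: for a box of even side in every direction there is
an energy minimising configuration of period `2` in all coordinate directions.

This file proves the theorem for the RING `Λ = ℤ/Lℤ` (`d = 1`, the spin chain of Cross–Fisher,
eq. (1.10)), `L` even, `L ≥ 4`, every spin `n/2` and every `f`:

* `SpinPeierlsRing.energy n f J = λ₀(Σ_c J_c 𝐒_c·𝐒_{c+1}) + Σ_c f(J_c)` on the torus
  `TorusSite 1 L`, with the tree's weighted antiferromagnet `heisWeightedHamiltonian`;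
* `energy_reflLAt_add_energy_reflRAt_le` — the reflection inequality of the proof of Theorem 4
  (`HeisenbergCouplingReflection.heis_groundEnergy_reflectWeight_le_zero`, Dyson–Lieb–Simon) for
  the couplings `(J^l, J^m, θJ^l)`, `(θJ^r, J^m, J^r)` at every pair of planes between sites;
* **`exists_dimerized_minimizer`** — if the minimum of the energy over nonnegative coupling
  configurations is attained (at `J`), it is attained at a configuration with `J_{c+2} = J_c`
  for all `c` ("proved in the same way as Theorem 1": the pair count of
  `PeierlsInstabilityRing` — `PeierlsRing.two_mul_pairCount_add_two_le` — is reused verbatim on the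
  relative bond coordinates of each plane; no flux and no `L mod 4` dichotomy arise).

The general form — Theorem 4 for the box `(ℤ/Lℤ)^d`, every `d`, with bonds indexed by
`(x, k) ↦ {x, x + e_k}` — is `SpinPeierls.exists_periodTwo_minimizer` in
`SpinPeierlsDimerization.lean`; this file is the ring in ring coordinates `J : ℤ/Lℤ → ℝ`.

## References

* [LiebNachtergaele1995] E. H. Lieb, B. Nachtergaele, Phys. Rev. B 51 (1995) 4777, eq. (1.9),
  Theorem 4 and its proof (§3).
* [DLS1978] F. J. Dyson, E. H. Lieb, B. Simon, J. Stat. Phys. 18 (1978) 335–383 (reflection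
  positivity of the antiferromagnet).
-/

noncomputable section

open Matrix Finset Literature.Probability.LatticeModels

namespace Literature.MathematicalPhysics.QuantumLattice

namespace SpinPeierlsRing

variable {L : ℕ} [NeZero L]

/-! ### The ring `ℤ/Lℤ` as the torus `TorusSite 1 L` -/

/-- The site `c` of the ring. [cite: LiebNachtergaele1995, eq. (1.9)] -/
def rsite (c : ZMod L) : TorusSite 1 L := fun _ => c

omit [NeZero L] in
/-- Unfolding lemma. [cite: LiebNachtergaele1995, eq. (1.9)] -/
@[simp] theorem rsite_apply (c : ZMod L) (i : Fin 1) : rsite c i = c := rfl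

omit [NeZero L] in
/-- Every site of `TorusSite 1 L` is an `rsite`. [cite: LiebNachtergaele1995, eq. (1.9)] -/
theorem rsite_eval (x : TorusSite 1 L) : rsite (x 0) = x :=
  funext fun i => by rw [Fin.fin_one_eq_zero i]; rfl

/-- The sites of the ring are `ℤ/Lℤ`. [cite: LiebNachtergaele1995, eq. (1.9)] -/
def rsiteEquiv : ZMod L ≃ TorusSite 1 L where
  toFun := rsite
  invFun x := x 0
  left_inv _ := rfl
  right_inv x := rsite_eval x

omit [NeZero L] in
/-- The unit vector of the ring is the constant `1`. [cite: LiebNachtergaele1995, eq. (1.9)] -/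
theorem rsite_add_single (c : ZMod L) (i : Fin 1) :
    rsite c + Pi.single i (1 : ZMod L) = rsite (c + 1) := by
  funext k
  rw [Fin.fin_one_eq_zero i, Fin.fin_one_eq_zero k, Pi.add_apply, Pi.single_eq_same]
  rfl

/-- The bond `{c, c+1}` of the ring. [cite: LiebNachtergaele1995, eq. (1.9) (`J_j ≡ J_{j,j+1}`)] -/
def rbond (c : ZMod L) : Sym2 (TorusSite 1 L) := s(rsite c, rsite (c + 1))

omit [NeZero L] in
/-- **Nearest neighbours on the ring.** [cite: LiebNachtergaele1995, eq. (1.9)] -/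
theorem adj_rsite_iff (h3 : 3 ≤ L) (c c' : ZMod L) :
    (torusGraph 1 L).Adj (rsite c) (rsite c') ↔ c' = c + 1 ∨ c = c' + 1 := by
  haveI : Fact (1 < L) := ⟨by omega⟩
  rw [torusGraph_adj_iff]
  constructor
  · rintro ⟨-, ⟨i, hi⟩ | ⟨i, hi⟩⟩
    · left
      rw [rsite_add_single] at hi
      simpa using congrFun hi 0
    · right
      rw [rsite_add_single] at hi
      simpa using congrFun hi 0
  · intro h
    refine ⟨fun heq => ?_, ?_⟩
    · have hc : c = c' := by simpa using congrFun heq 0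
      rcases h with h | h
      · exact one_ne_zero (by rw [hc] at h; linear_combination -h)
      · exact one_ne_zero (by rw [hc] at h; linear_combination -h)
    · rcases h with h | h
      · exact Or.inl ⟨0, by rw [rsite_add_single, h]⟩
      · exact Or.inr ⟨0, by rw [rsite_add_single, h]⟩

/-- The bonds of the ring are edges of the torus graph. [cite: LiebNachtergaele1995, eq. (1.9)] -/
theorem rbond_mem_edgeFinset (h3 : 3 ≤ L) (c : ZMod L) : rbond c ∈ (torusGraph 1 L).edgeFinset := by
  rw [rbond, SimpleGraph.mem_edgeFinset, SimpleGraph.mem_edgeSet, adj_rsite_iff h3]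
  exact Or.inl rfl

/-- Every edge of the ring is a bond `{c, c+1}`. [cite: LiebNachtergaele1995, eq. (1.9)] -/
theorem exists_eq_rbond (h3 : 3 ≤ L) {e : Sym2 (TorusSite 1 L)} (he : e ∈ (torusGraph 1 L).edgeFinset) :
    ∃ c, e = rbond c := by
  induction e using Sym2.ind with
  | h x y =>
    rw [SimpleGraph.mem_edgeFinset, SimpleGraph.mem_edgeSet, ← rsite_eval x, ← rsite_eval y,
      adj_rsite_iff h3] at he
    rcases he with h | h
    · exact ⟨x 0, by rw [rbond, ← h, rsite_eval, rsite_eval]⟩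
    · exact ⟨y 0, by rw [rbond, ← h, rsite_eval, rsite_eval, Sym2.eq_swap]⟩

/-- **Sums over the bonds of the ring.** [cite: LiebNachtergaele1995, eq. (1.9)] -/
theorem sum_edgeFinset_eq (h3 : 3 ≤ L) {M : Type*} [AddCommMonoid M] (F : Sym2 (TorusSite 1 L) → M) :
    ∑ e ∈ (torusGraph 1 L).edgeFinset, F e = ∑ c : ZMod L, F (rbond c) := by
  rw [← sum_pairs_eq_sum_edgeFinset' L h3]
  simp only [Fin.sum_univ_one]
  exact (Fintype.sum_equiv rsiteEquiv (fun c => F (rbond c)) (fun x => F s(x, x + Pi.single 0 1))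
    (fun c => by rw [rbond, ← rsite_add_single c 0]; rfl)).symm

/-! ### The couplings, the Hamiltonian and the energy -/

/-- The coupling configuration `J : ℤ/Lℤ → ℝ` (`J_c` on the bond `{c, c+1}`) as a weight on
unordered pairs of sites (zero off the bonds). [cite: LiebNachtergaele1995, eq. (1.9)] -/
def coupling (J : ZMod L → ℝ) : Sym2 (TorusSite 1 L) → ℝ :=
  Sym2.lift ⟨fun x y => (if y 0 = x 0 + 1 then J (x 0) else 0) + (if x 0 = y 0 + 1 then J (y 0) else 0),
    fun _ _ => add_comm _ _⟩

omit [NeZero L] in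
/-- `coupling J {c, c+1} = J_c` (`L ≥ 3`). [cite: LiebNachtergaele1995, eq. (1.9)] -/
theorem coupling_rbond (h3 : 3 ≤ L) (J : ZMod L → ℝ) (c : ZMod L) : coupling J (rbond c) = J c := by
  have hne : ¬(c = c + 1 + 1) := fun h => PeierlsRing.two_ne_zero h3 (by linear_combination -h)
  simp only [coupling, rbond, Sym2.lift_mk, rsite_apply, if_neg hne, add_zero]
  simp

omit [NeZero L] in
/-- Nonnegative couplings give a nonnegative weight. [cite: LiebNachtergaele1995, eq. (1.9)] -/
theorem coupling_nonneg {J : ZMod L → ℝ} (hJ : ∀ c, 0 ≤ J c) (e : Sym2 (TorusSite 1 L)) :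
    0 ≤ coupling J e := by
  induction e using Sym2.ind with
  | h x y =>
    simp only [coupling, Sym2.lift_mk]
    exact add_nonneg (by split_ifs <;> simp [hJ]) (by split_ifs <;> simp [hJ])

/-- **The spin-Peierls Hamiltonian of the ring** `Σ_c J_c 𝐒_c·𝐒_{c+1}`, spin `n/2`
(eq. (1.9) without the elastic term). [cite: LiebNachtergaele1995, eq. (1.9)] -/
def hamiltonian (n : ℕ) (J : ZMod L → ℝ) : Op (TorusSite 1 L) (n + 1) :=
  heisWeightedHamiltonian L n (coupling J)

/-- **The spin-Peierls energy** `λ₀(Σ_c J_c 𝐒_c·𝐒_{c+1}) + Σ_c f(J_c)` (the smallest eigenvalue of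
`H_Λ` of eq. (1.9)). [cite: LiebNachtergaele1995, eq. (1.9)] -/
def energy (n : ℕ) (f : ℝ → ℝ) (J : ZMod L → ℝ) : ℝ :=
  (hamiltonian n J).groundEnergy + ∑ c, f (J c)

/-- **Minimisers** of the spin-Peierls energy among the antiferromagnetic (`J ≥ 0`) coupling
configurations. [cite: LiebNachtergaele1995, §1 (the spin-Peierls problem), Theorem 4] -/
def IsMinimizer (n : ℕ) (f : ℝ → ℝ) (J : ZMod L → ℝ) : Prop :=
  (∀ c, 0 ≤ J c) ∧ ∀ J' : ZMod L → ℝ, (∀ c, 0 ≤ J' c) → energy n f J ≤ energy n f J'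

/-- A minimiser is antiferromagnetic. [cite: LiebNachtergaele1995, Theorem 4] -/
theorem IsMinimizer.nonneg {n : ℕ} {f : ℝ → ℝ} {J : ZMod L → ℝ} (h : IsMinimizer n f J) (c : ZMod L) :
    0 ≤ J c := h.1 c

/-- A minimiser minimises. [cite: LiebNachtergaele1995, Theorem 4] -/
theorem IsMinimizer.le {n : ℕ} {f : ℝ → ℝ} {J : ZMod L → ℝ} (h : IsMinimizer n f J)
    {J' : ZMod L → ℝ} (hJ' : ∀ c, 0 ≤ J' c) : energy n f J ≤ energy n f J' := h.2 J' hJ'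

/-- The weighted Hamiltonian only sees the weight on the edges. [cite: KLS1988JSP, eq. (5)] -/
theorem heisWeightedHamiltonian_congr_edges {d : ℕ} {L : ℕ} [NeZero L] (n : ℕ)
    {w₁ w₂ : Sym2 (TorusSite d L) → ℝ} (h : ∀ e ∈ (torusGraph d L).edgeFinset, w₁ e = w₂ e) :
    heisWeightedHamiltonian L n w₁ = heisWeightedHamiltonian L n w₂ := by
  unfold heisWeightedHamiltonian
  exact sum_congr rfl fun e he => by rw [h e he]

/-! ### The planes between sites and the reflected couplings -/

/-- A site is in the left half of the planes `(a | a+1)`, `(a+L/2 | a+L/2+1)` iff its coordinate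
relative to `a + 1` is `< L/2` — the ring geometry of `PeierlsInstabilityRing` in the relative
coordinate `c - a - 1`. [cite: LiebNachtergaele1995, §3] -/
theorem rsite_mem_torusLeftHalf_iff (a c : ZMod L) :
    rsite c ∈ torusLeftHalf L 0 a ↔ FermionTorus.Cut.IsLeft L (PeierlsRing.site (c - a - 1)) := by
  rw [mem_torusLeftHalf, PeierlsRing.isLeft_site_iff, rsite_apply, sub_add_eq_sub_sub]

omit [NeZero L] in
/-- Membership in a bond. [cite: LiebNachtergaele1995, eq. (1.9)] -/
theorem forall_mem_rbond {p : TorusSite 1 L → Prop} (c : ZMod L) :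
    (∀ x ∈ rbond c, p x) ↔ p (rsite c) ∧ p (rsite (c + 1)) := by
  simp only [rbond, Sym2.mem_iff, or_imp, forall_and, forall_eq]

/-- Left bonds of the planes at `a` are the left bonds of `PeierlsInstabilityRing` in the
relative coordinate. [cite: LiebNachtergaele1995, §3] -/
theorem rbond_mem_torusLeftEdges_iff (h3 : 3 ≤ L) (a c : ZMod L) :
    rbond c ∈ torusLeftEdges L 0 a ↔ PeierlsRing.IsLeftBond (c - a - 1) := by
  rw [torusLeftEdges, mem_filter, and_iff_right (rbond_mem_edgeFinset h3 c), forall_mem_rbond,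
    rsite_mem_torusLeftHalf_iff, rsite_mem_torusLeftHalf_iff, PeierlsRing.IsLeftBond,
    show c + 1 - a - 1 = c - a - 1 + 1 by ring]

/-- Right bonds likewise. [cite: LiebNachtergaele1995, §3] -/
theorem rbond_right_iff (a c : ZMod L) :
    (∀ x ∈ rbond c, x ∉ torusLeftHalf L 0 a) ↔ PeierlsRing.IsRightBond (c - a - 1) := by
  rw [forall_mem_rbond, rsite_mem_torusLeftHalf_iff, rsite_mem_torusLeftHalf_iff,
    PeierlsRing.IsRightBond, show c + 1 - a - 1 = c - a - 1 + 1 by ring]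

omit [NeZero L] in
/-- The reflection of the sites: `c ↦ 2a + 1 - c`. [cite: LiebNachtergaele1995, §3] -/
theorem reflect_rsite (a c : ZMod L) :
    Torus.reflectBetweenSites 0 a (rsite c) = rsite (2 * a + 1 - c) := by
  funext k
  rw [Fin.fin_one_eq_zero k, Torus.reflectBetweenSites_apply, Function.update_self, rsite_apply,
    rsite_apply]

omit [NeZero L] in
/-- The reflection of the bonds: `{c, c+1} ↦ {2a - c, 2a + 1 - c}`. [cite: LiebNachtergaele1995, §3] -/
theorem map_rbond (a c : ZMod L) :
    (rbond c).map (Torus.reflectBetweenSites 0 a) = rbond (2 * a - c) := by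
  have h1 : Torus.reflectBetweenSites 0 a (rsite c) = rsite (2 * a - c + 1) := by
    rw [reflect_rsite]; congr 1; ring
  have h2 : Torus.reflectBetweenSites 0 a (rsite (c + 1)) = rsite (2 * a - c) := by
    rw [reflect_rsite]; congr 1; ring
  rw [rbond, rbond, Sym2.map_mk, h1, h2, Sym2.eq_swap]

/-- **The couplings `(J^l, J^m, θJ^l)` of the planes at `a`**: `J` on the left and crossing
bonds, the mirrored coupling `J_{2a-c}` on the right bonds `c`.
[cite: LiebNachtergaele1995, §3 (proof of Theorem 4)] -/
def reflLAt (a : ZMod L) (J : ZMod L → ℝ) : ZMod L → ℝ := fun c =>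
  if PeierlsRing.IsRightBond (c - a - 1) then J (2 * a - c) else J c

/-- **The couplings `(θJ^r, J^m, J^r)` of the planes at `a`.**
[cite: LiebNachtergaele1995, §3 (proof of Theorem 4)] -/
def reflRAt (a : ZMod L) (J : ZMod L → ℝ) : ZMod L → ℝ := fun c =>
  if PeierlsRing.IsLeftBond (c - a - 1) then J (2 * a - c) else J c

/-- Unfolding lemma. [cite: LiebNachtergaele1995, §3] -/
theorem reflLAt_apply (a : ZMod L) (J : ZMod L → ℝ) (c : ZMod L) :
    reflLAt a J c = if PeierlsRing.IsRightBond (c - a - 1) then J (2 * a - c) else J c := rfl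

/-- Unfolding lemma. [cite: LiebNachtergaele1995, §3] -/
theorem reflRAt_apply (a : ZMod L) (J : ZMod L → ℝ) (c : ZMod L) :
    reflRAt a J c = if PeierlsRing.IsLeftBond (c - a - 1) then J (2 * a - c) else J c := rfl

/-- Reflected antiferromagnetic couplings are antiferromagnetic. [cite: LiebNachtergaele1995, §3] -/
theorem reflLAt_nonneg (a : ZMod L) {J : ZMod L → ℝ} (hJ : ∀ c, 0 ≤ J c) (c : ZMod L) :
    0 ≤ reflLAt a J c := by
  rw [reflLAt_apply]; split_ifs <;> exact hJ _

/-- Reflected antiferromagnetic couplings are antiferromagnetic. [cite: LiebNachtergaele1995, §3] -/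
theorem reflRAt_nonneg (a : ZMod L) {J : ZMod L → ℝ} (hJ : ∀ c, 0 ≤ J c) (c : ZMod L) :
    0 ≤ reflRAt a J c := by
  rw [reflRAt_apply]; split_ifs <;> exact hJ _

/-- The reflected weight of `HeisenbergCouplingReflection` on the bonds is `reflLAt`.
[cite: LiebNachtergaele1995, §3 (proof of Theorem 4)] -/
theorem reflectWeightLeft_coupling_rbond (h3 : 3 ≤ L) (a : ZMod L) (J : ZMod L → ℝ) (c : ZMod L) :
    reflectWeightLeft L 0 a (coupling J) (rbond c) = reflLAt a J c := by
  by_cases h : PeierlsRing.IsRightBond (c - a - 1)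
  · rw [reflectWeightLeft_apply, if_pos ((rbond_right_iff a c).2 h), reflLAt_apply, if_pos h,
      map_rbond, coupling_rbond h3]
  · rw [reflectWeightLeft_apply, if_neg (fun h' => h ((rbond_right_iff a c).1 h')), reflLAt_apply,
      if_neg h, coupling_rbond h3]

/-- The reflected weight of `HeisenbergCouplingReflection` on the bonds is `reflRAt`.
[cite: LiebNachtergaele1995, §3 (proof of Theorem 4)] -/
theorem reflectWeightRight_coupling_rbond (h3 : 3 ≤ L) (a : ZMod L) (J : ZMod L → ℝ) (c : ZMod L) :
    reflectWeightRight L 0 a (coupling J) (rbond c) = reflRAt a J c := by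
  by_cases h : PeierlsRing.IsLeftBond (c - a - 1)
  · rw [reflectWeightRight_apply, if_pos ((forall_mem_rbond c).2
        ⟨(rsite_mem_torusLeftHalf_iff a c).2 h.1,
          (rsite_mem_torusLeftHalf_iff a (c + 1)).2 (by rw [show c + 1 - a - 1 = c - a - 1 + 1 by ring]; exact h.2)⟩),
      reflRAt_apply, if_pos h, map_rbond, coupling_rbond h3]
  · rw [reflectWeightRight_apply, if_neg (fun h' => h ((rbond_mem_torusLeftEdges_iff h3 a c).1
        (mem_filter.2 ⟨rbond_mem_edgeFinset h3 c, h'⟩))), reflRAt_apply, if_neg h, coupling_rbond h3]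

/-- The Hamiltonian of the reflected weight is the Hamiltonian of `reflLAt`.
[cite: LiebNachtergaele1995, §3 (proof of Theorem 4)] -/
theorem hamiltonian_reflLAt (h3 : 3 ≤ L) (n : ℕ) (a : ZMod L) (J : ZMod L → ℝ) :
    heisWeightedHamiltonian L n (reflectWeightLeft L 0 a (coupling J)) = hamiltonian n (reflLAt a J) := by
  refine heisWeightedHamiltonian_congr_edges n fun e he => ?_
  obtain ⟨c, rfl⟩ := exists_eq_rbond h3 he
  rw [reflectWeightLeft_coupling_rbond h3, coupling_rbond h3]

/-- The Hamiltonian of the reflected weight is the Hamiltonian of `reflRAt`.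
[cite: LiebNachtergaele1995, §3 (proof of Theorem 4)] -/
theorem hamiltonian_reflRAt (h3 : 3 ≤ L) (n : ℕ) (a : ZMod L) (J : ZMod L → ℝ) :
    heisWeightedHamiltonian L n (reflectWeightRight L 0 a (coupling J)) = hamiltonian n (reflRAt a J) := by
  refine heisWeightedHamiltonian_congr_edges n fun e he => ?_
  obtain ⟨c, rfl⟩ := exists_eq_rbond h3 he
  rw [reflectWeightRight_coupling_rbond h3, coupling_rbond h3]

/-! ### Relative bond coordinates: the pair count of `PeierlsInstabilityRing` -/

/-- The couplings in the coordinate relative to the planes at `a` (bond `j ↦ a + 1 + j`), as a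
complex configuration of `PeierlsInstabilityRing`. [cite: LiebNachtergaele1995, §3] -/
def rel (a : ZMod L) (J : ZMod L → ℝ) : ZMod L → ℂ := fun j => ((J (a + 1 + j) : ℝ) : ℂ)

omit [NeZero L] in
/-- `|rel a J j| = J_{a+1+j}` for `J ≥ 0`. [cite: LiebNachtergaele1995, §3] -/
theorem norm_rel (a : ZMod L) {J : ZMod L → ℝ} (hJ : ∀ c, 0 ≤ J c) (j : ZMod L) :
    ‖rel a J j‖ = J (a + 1 + j) := by
  rw [rel, Complex.norm_real, Real.norm_of_nonneg (hJ _)]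

/-- `reflLAt` in the relative coordinate. [cite: LiebNachtergaele1995, §3] -/
theorem reflLAt_add (a : ZMod L) (J : ZMod L → ℝ) (j : ZMod L) :
    reflLAt a J (a + 1 + j) =
      if PeierlsRing.IsRightBond j then J (a + 1 + PeierlsRing.bondRefl j) else J (a + 1 + j) := by
  have h1 : a + 1 + j - a - 1 = j := by ring
  have h2 : 2 * a - (a + 1 + j) = a + 1 + PeierlsRing.bondRefl j := by rw [PeierlsRing.bondRefl]; ring
  simp only [reflLAt_apply, h1, h2]

/-- `reflRAt` in the relative coordinate. [cite: LiebNachtergaele1995, §3] -/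
theorem reflRAt_add (a : ZMod L) (J : ZMod L → ℝ) (j : ZMod L) :
    reflRAt a J (a + 1 + j) =
      if PeierlsRing.IsLeftBond j then J (a + 1 + PeierlsRing.bondRefl j) else J (a + 1 + j) := by
  have h1 : a + 1 + j - a - 1 = j := by ring
  have h2 : 2 * a - (a + 1 + j) = a + 1 + PeierlsRing.bondRefl j := by rw [PeierlsRing.bondRefl]; ring
  simp only [reflRAt_apply, h1, h2]

/-- The moduli of Lieb–Nachtergaele's `reflL` of the relative configuration are the relative
configuration of `reflLAt` (the sign/conjugation of the fermionic problem is invisible in the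
moduli). [cite: LiebNachtergaele1995, §3] -/
theorem norm_reflL_rel (a : ZMod L) {J : ZMod L → ℝ} (hJ : ∀ c, 0 ≤ J c) (j : ZMod L) :
    ‖PeierlsRing.reflL (rel a J) j‖ = ‖rel a (reflLAt a J) j‖ := by
  rw [norm_rel a (reflLAt_nonneg a hJ), reflLAt_add, PeierlsRing.reflL_apply]
  split_ifs
  · rw [norm_neg, norm_star, norm_rel a hJ]
  · rw [norm_rel a hJ]

/-- Same for `reflR`. [cite: LiebNachtergaele1995, §3] -/
theorem norm_reflR_rel (a : ZMod L) {J : ZMod L → ℝ} (hJ : ∀ c, 0 ≤ J c) (j : ZMod L) :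
    ‖PeierlsRing.reflR (rel a J) j‖ = ‖rel a (reflRAt a J) j‖ := by
  rw [norm_rel a (reflRAt_nonneg a hJ), reflRAt_add, PeierlsRing.reflR_apply]
  split_ifs
  · rw [norm_neg, norm_star, norm_rel a hJ]
  · rw [norm_rel a hJ]

/-- Sums over the bonds in the relative coordinate. [cite: LiebNachtergaele1995, §3] -/
theorem sum_rel (a : ZMod L) (g : ZMod L → ℝ) : ∑ j, g (a + 1 + j) = ∑ c, g c :=
  Fintype.sum_equiv (Equiv.addLeft (a + 1)) _ _ fun _ => rfl

/-! ### The reflection inequality for the spin-Peierls energy -/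

/-- **The reflection inequality of the proof of Theorem 4 on the ring**: for antiferromagnetic
couplings `J ≥ 0` and every pair of planes between sites,
`𝓔(J^l, J^m, θJ^l) + 𝓔(θJ^r, J^m, J^r) ≤ 2 𝓔(J)` — the magnetic part is Dyson–Lieb–Simon
reflection positivity in the couplings (`heis_groundEnergy_reflectWeight_le_zero`), the elastic
part is split evenly (`PeierlsRing.elastic_reflL_add_reflR`).
[cite: LiebNachtergaele1995, §3 (proof of Theorem 4)] [cite: DLS1978, Thm. 6.1] -/
theorem energy_reflLAt_add_energy_reflRAt_le (hL : Even L) (h4 : 4 ≤ L) (n : ℕ) (f : ℝ → ℝ)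
    (a : ZMod L) {J : ZMod L → ℝ} (hJ : ∀ c, 0 ≤ J c) :
    energy n f (reflLAt a J) + energy n f (reflRAt a J) ≤ 2 * energy n f J := by
  have h3 : 3 ≤ L := by omega
  -- magnetic part
  have hmag := heis_groundEnergy_reflectWeight_le_zero L 0 a n hL h3 (w := coupling J)
    (fun x _ => coupling_nonneg hJ _)
  rw [hamiltonian_reflLAt h3, hamiltonian_reflRAt h3] at hmag
  -- elastic part, through the relative coordinate
  have hel := PeierlsRing.elastic_reflL_add_reflR hL f (rel a J)
  simp only [norm_reflL_rel a hJ, norm_reflR_rel a hJ, norm_rel a hJ, norm_rel a (reflLAt_nonneg a hJ),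
    norm_rel a (reflRAt_nonneg a hJ)] at hel
  rw [sum_rel a (fun c => f (reflLAt a J c)), sum_rel a (fun c => f (reflRAt a J c)),
    sum_rel a (fun c => f (J c))] at hel
  unfold energy hamiltonian
  unfold hamiltonian at hmag
  linarith

/-- Both reflected configurations of a minimiser are minimisers.
[cite: LiebNachtergaele1995, §3 (proof of Theorem 4: "and also be minimizing")] -/
theorem IsMinimizer.reflAt (hL : Even L) (h4 : 4 ≤ L) {n : ℕ} {f : ℝ → ℝ} {J : ZMod L → ℝ}
    (h : IsMinimizer n f J) (a : ZMod L) :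
    IsMinimizer n f (reflLAt a J) ∧ IsMinimizer n f (reflRAt a J) := by
  have hle := energy_reflLAt_add_energy_reflRAt_le hL h4 n f a h.1
  have h₁ := h.le (reflLAt_nonneg a h.1)
  have h₂ := h.le (reflRAt_nonneg a h.1)
  exact ⟨⟨reflLAt_nonneg a h.1, fun J' hJ' => by linarith [h.le hJ']⟩,
    ⟨reflRAt_nonneg a h.1, fun J' hJ' => by linarith [h.le hJ']⟩⟩

/-! ### Pairs of identical couplings `J_{c+2} = J_c` -/

/-- **The number of pairs `(c, c+2)` of identical couplings.**
[cite: LiebNachtergaele1995, §3 (proof of Theorem 1, reused for Theorem 4)] -/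
def pairCount (J : ZMod L → ℝ) : ℕ := #(univ.filter fun c : ZMod L => J (c + 2) = J c)

/-- `pairCount ≤ L`. [cite: LiebNachtergaele1995, §3] -/
theorem pairCount_le (J : ZMod L → ℝ) : pairCount J ≤ L := by
  unfold pairCount
  exact (card_filter_le _ _).trans (by rw [card_univ, ZMod.card])

/-- All pairs are identical iff `pairCount = L`. [cite: LiebNachtergaele1995, §3] -/
theorem forall_eq_of_le_pairCount {J : ZMod L → ℝ} (h : L ≤ pairCount J) (c : ZMod L) :
    J (c + 2) = J c := by
  have hc : #(univ.filter fun c : ZMod L => J (c + 2) = J c) = #(univ : Finset (ZMod L)) :=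
    le_antisymm (card_filter_le _ _) (by rw [card_univ, ZMod.card]; exact h)
  exact (card_filter_eq_iff.1 hc) c (mem_univ c)

/-- The pair count is the pair count of `PeierlsInstabilityRing` of the relative configuration
(for `J ≥ 0`). [cite: LiebNachtergaele1995, §3] -/
theorem pairCount_eq_rel (a : ZMod L) {J : ZMod L → ℝ} (hJ : ∀ c, 0 ≤ J c) :
    pairCount J = PeierlsRing.pairCount (rel a J) := by
  unfold pairCount PeierlsRing.pairCount
  refine (card_equiv (Equiv.addLeft (a + 1)) fun j => ?_).symm
  simp only [mem_filter, mem_univ, true_and, Equiv.coe_addLeft, norm_rel a hJ,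
    show a + 1 + (j + 2) = a + 1 + j + 2 by ring]

/-- **The pair-count inequality of the descent** (`PeierlsRing.two_mul_pairCount_le` in the
relative coordinate): `2 N(J) ≤ N(J^L) + N(J^R)` for `J ≥ 0`.
[cite: LiebNachtergaele1995, §3 (proof of Theorem 1, "at least as many pairs")] -/
theorem two_mul_pairCount_le (hL : Even L) (h4 : 4 ≤ L) (a : ZMod L) {J : ZMod L → ℝ}
    (hJ : ∀ c, 0 ≤ J c) : 2 * pairCount J ≤ pairCount (reflLAt a J) + pairCount (reflRAt a J) := by
  rw [pairCount_eq_rel a hJ, pairCount_eq_rel a (reflLAt_nonneg a hJ), pairCount_eq_rel a (reflRAt_nonneg a hJ),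
    ← PeierlsRing.pairCount_congr (norm_reflL_rel a hJ), ← PeierlsRing.pairCount_congr (norm_reflR_rel a hJ)]
  exact PeierlsRing.two_mul_pairCount_le hL h4 _

/-- … **and strictly more when the pair `(a-1, a+1)` straddling the plane is unequal**:
`2 N(J) + 2 ≤ N(J^L) + N(J^R)`. [cite: LiebNachtergaele1995, §3 (proof of Theorem 1)] -/
theorem two_mul_pairCount_add_two_le (hL : Even L) (h4 : 4 ≤ L) (a : ZMod L) {J : ZMod L → ℝ}
    (hJ : ∀ c, 0 ≤ J c) (hne : J (a + 1) ≠ J (a - 1)) :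
    2 * pairCount J + 2 ≤ pairCount (reflLAt a J) + pairCount (reflRAt a J) := by
  rw [pairCount_eq_rel a hJ, pairCount_eq_rel a (reflLAt_nonneg a hJ), pairCount_eq_rel a (reflRAt_nonneg a hJ),
    ← PeierlsRing.pairCount_congr (norm_reflL_rel a hJ), ← PeierlsRing.pairCount_congr (norm_reflR_rel a hJ)]
  refine PeierlsRing.two_mul_pairCount_add_two_le hL h4 ?_
  rwa [norm_rel a hJ, norm_rel a hJ, add_zero, show a + 1 + -2 = a - 1 by ring]

/-! ### The descent and Theorem 4 on the ring -/

/-- **One step at the planes `a`**: both reflected configurations of a minimiser are minimisers,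
together they have at least `2 N(J)` pairs of identical couplings, and `2 N(J) + 2` if
`J_{a+1} ≠ J_{a-1}`. [cite: LiebNachtergaele1995, §3 (proofs of Theorems 1 and 4)] -/
theorem step (hL : Even L) (h4 : 4 ≤ L) {n : ℕ} {f : ℝ → ℝ} {J : ZMod L → ℝ} (hmin : IsMinimizer n f J)
    (a : ZMod L) :
    ∃ J₁ J₂ : ZMod L → ℝ, IsMinimizer n f J₁ ∧ IsMinimizer n f J₂ ∧
      2 * pairCount J ≤ pairCount J₁ + pairCount J₂ ∧
      (J (a + 1) ≠ J (a - 1) → 2 * pairCount J + 2 ≤ pairCount J₁ + pairCount J₂) :=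
  ⟨reflLAt a J, reflRAt a J, (hmin.reflAt hL h4 a).1, (hmin.reflAt hL h4 a).2,
    two_mul_pairCount_le hL h4 a hmin.1, two_mul_pairCount_add_two_le hL h4 a hmin.1⟩

/-- **The descent**: from any minimiser, a minimiser all of whose pairs `(c, c+2)` are identical
("the argument can be repeated … yielding finally a minimizing configuration in which all pairs
are identical"). [cite: LiebNachtergaele1995, §3 (proofs of Theorems 1 and 4)] -/
theorem exists_minimizer_forall_eq (hL : Even L) (h4 : 4 ≤ L) {n : ℕ} {f : ℝ → ℝ}
    {J : ZMod L → ℝ} (hmin : IsMinimizer n f J) :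
    ∃ J' : ZMod L → ℝ, IsMinimizer n f J' ∧ ∀ c, J' (c + 2) = J' c := by
  suffices h : ∀ m : ℕ, ∀ J : ZMod L → ℝ, IsMinimizer n f J → L - pairCount J ≤ m →
      ∃ J' : ZMod L → ℝ, IsMinimizer n f J' ∧ ∀ c, J' (c + 2) = J' c from h _ J hmin le_rfl
  intro m
  induction m with
  | zero =>
    intro J hJ hm
    exact ⟨J, hJ, forall_eq_of_le_pairCount (by omega)⟩
  | succ m ih =>
    intro J hJ hm
    by_cases hall : ∀ c, J (c + 2) = J c
    · exact ⟨J, hJ, hall⟩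
    · obtain ⟨c₀, hc₀⟩ := not_forall.1 hall
      obtain ⟨J₁, J₂, h₁, h₂, -, hc⟩ := step hL h4 hJ (c₀ + 1)
      have hc' := hc (by
        rw [show c₀ + 1 + 1 = c₀ + 2 by ring, add_sub_cancel_right]; exact hc₀)
      have hlt : pairCount J < L := by
        by_contra hge
        exact hc₀ (forall_eq_of_le_pairCount (by omega) c₀)
      have hle₁ := pairCount_le J₁
      have hle₂ := pairCount_le J₂
      by_cases h1 : pairCount J + 1 ≤ pairCount J₁
      · exact ih J₁ h₁ (by omega)
      · exact ih J₂ h₂ (by omega)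

/-- **Theorem 4 of Lieb–Nachtergaele on the ring (dimerization for spin-Peierls, `d = 1`).**
For the antiferromagnetic spin-`n/2` Heisenberg ring of even length `L ≥ 4` coupled to lattice
distortions through an arbitrary elastic energy `f`: if the minimum of
`λ₀(Σ_c J_c 𝐒_c·𝐒_{c+1}) + Σ_c f(J_c)` over the coupling configurations `J ≥ 0` is attained, then
it is attained at a configuration of period `2`, `J_{c+2} = J_c`.
[cite: LiebNachtergaele1995, Theorem 4 (`d = 1`)] -/
theorem exists_dimerized_minimizer (hL : Even L) (h4 : 4 ≤ L) (n : ℕ) (f : ℝ → ℝ)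
    {J : ZMod L → ℝ} (hmin : IsMinimizer n f J) :
    ∃ J' : ZMod L → ℝ, IsMinimizer n f J' ∧ energy n f J' = energy n f J ∧
      PeierlsRing.IsDimerized J' := by
  -- the box `(ℤ/Lℤ)^d`, every `d`: `SpinPeierls.exists_periodTwo_minimizer` (SpinPeierlsDimerization)
  obtain ⟨J', h', hall⟩ := exists_minimizer_forall_eq hL h4 hmin
  exact ⟨J', h', le_antisymm (h'.le hmin.1) (hmin.le h'.1), hall⟩

end SpinPeierlsRing

end Literature.MathematicalPhysics.QuantumLattice

end
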